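import Literature.Probability.Percolation.Percolation
import Mathlib.Combinatorics.SimpleGraph.Connectivity.Finite
import HarnessLib

/-!
# `NoHeavyLowerTail` (stmt-CriticalPhenomena-4575) — antithetic cluster pairs: the CHERRY FAN IS ⊕-POSITIVE (prim-hp-2 gen 58)

Support file (`--supports stmt-CriticalPhenomena-4575`, hull-port prover `prim-hp-2`, gen 58).  No definitions, no named facts, no sorries.
COMPUTATIONAL (`decide` / `native_decide` on an explicit 8-vertex configuration space; axioms standard + `Lean.ofReduceBool`).

The CHERRY FAN inside `Fin 8`: source `s = 0`, hub `y = 1`, leaves `a = 2`, `b = 3`, edge set `E₁ = {01, 12, 13, 02, 03}` (the vertices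
`4..7` are idle — this is the `y`-side of FAT8, MEMO-gen54/56).  For a sub-colouring `θ ⊆ E₁` (red edges) let `X θ = openCluster ↑θ 0`,
`Y θ = openCluster ↑(E₁ \ θ) 0` be the red / blue vertex clusters of `s`.
**`Antithetic.Cherry.cherry_oplus_powerset`**: for all twisted-monotone SUPER-ODD `K₁, K₂ : Set (Fin 8) → Set (Fin 8) → ℝ`,
`0 ≤ Σ_{θ ⊆ E₁, y ∈ X θ} K₁ (X θ) (Y θ) * K₂ (X θ) (Y θ)` — the ⊕-POSITIVITY of the cherry (HOME/THEOREM-OneSided.md: 23 colourings,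
9 crossing points matched to nested tops by red-dominated 1-cubes, 5 units of nested mass left as 0-cubes).  The certificate is checked
by `native_decide` (pair histogram = weighted cube endpoints, in ℕ) and `decide` (the inclusions of each cube); the symbolic part is
`one_cube_nonneg` / `zero_cube_nonneg` (a red-dominated 1-cube `{z ≼ z'}`, i.e. `z' ≽ z ∨ swap z`, has `K₁K₂(z) + K₁K₂(z') ≥ 0`).
With `Antithetic.sum_filter_inter_nonneg` (…AntitheticPairCertificate) this is the ⊕-hypothesis of `Antithetic.Cut.cutVertex_termTwo_nonneg`
for FAT8's `y`-side, hence (…AntitheticDegTwoOneSided) the vertex antithetic conjecture for FAT8 — assembled in a follow-up file.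
[cite: VandenbergHaggstromKahn2005, §1 p. 6 ("Harris' inequality")]
-/

namespace Summit.CriticalPhenomena.PercolationContinuityZ3.Theorems

open Literature.Probability.Percolation

namespace Antithetic

namespace Cherry

section Abstract

variable {V : Type*}

/-- A red-dominated 1-cube: `z = (P,Q) ≼ z' = (P',Q')` with `Q' ⊆ P` and `Q ⊆ P'`; for twisted-monotone super-odd `K₁, K₂`,
`K₁K₂(z) + K₁K₂(z') ≥ 0` (`K_i(z') ≥ |K_i(z)|`). [this work] -/
theorem one_cube_nonneg (P Q P' Q' : Set V) (hP : P ⊆ P') (hQ : Q' ⊆ Q) (hd1 : Q' ⊆ P) (hd2 : Q ⊆ P')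
    {K₁ K₂ : Set V → Set V → ℝ}
    (hK₁ : ∀ ⦃A A' B B' : Set V⦄, A ⊆ A' → B' ⊆ B → K₁ A B ≤ K₁ A' B') (hso₁ : ∀ A B, 0 ≤ K₁ A B + K₁ B A)
    (hK₂ : ∀ ⦃A A' B B' : Set V⦄, A ⊆ A' → B' ⊆ B → K₂ A B ≤ K₂ A' B') (hso₂ : ∀ A B, 0 ≤ K₂ A B + K₂ B A) :
    0 ≤ K₁ P Q * K₂ P Q + K₁ P' Q' * K₂ P' Q' := by
  have a1 : K₁ P Q ≤ K₁ P' Q' := hK₁ hP hQ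
  have a2 : K₁ Q P ≤ K₁ P' Q' := hK₁ hd2 hd1
  have a3 := hso₁ P Q
  have b1 : K₂ P Q ≤ K₂ P' Q' := hK₂ hP hQ
  have b2 : K₂ Q P ≤ K₂ P' Q' := hK₂ hd2 hd1
  have b3 := hso₂ P Q
  have h1 : 0 ≤ K₁ P' Q' - K₁ P Q := by linarith
  have h2 : 0 ≤ K₂ P' Q' - K₂ P Q := by linarith
  have h3 : 0 ≤ K₁ P' Q' + K₁ P Q := by linarith
  have h4 : 0 ≤ K₂ P' Q' + K₂ P Q := by linarith
  nlinarith [mul_nonneg h1 h2, mul_nonneg h3 h4]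

/-- A nested point (`Q ⊆ P`, a 0-cube) has `K₁K₂ ≥ 0`. [this work] -/
theorem zero_cube_nonneg (P Q : Set V) (hd : Q ⊆ P) {K₁ K₂ : Set V → Set V → ℝ}
    (hK₁ : ∀ ⦃A A' B B' : Set V⦄, A ⊆ A' → B' ⊆ B → K₁ A B ≤ K₁ A' B') (hso₁ : ∀ A B, 0 ≤ K₁ A B + K₁ B A)
    (hK₂ : ∀ ⦃A A' B B' : Set V⦄, A ⊆ A' → B' ⊆ B → K₂ A B ≤ K₂ A' B') (hso₂ : ∀ A B, 0 ≤ K₂ A B + K₂ B A) :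
    0 ≤ K₁ P Q * K₂ P Q := by
  have a2 : K₁ Q P ≤ K₁ P Q := hK₁ hd hd
  have a3 := hso₁ P Q
  have b2 : K₂ Q P ≤ K₂ P Q := hK₂ hd hd
  have b3 := hso₂ P Q
  exact mul_nonneg (by linarith) (by linarith)

/-- Fibre regrouping: `Σ_{a ∈ D} Φ (π a) = Σ_{z ∈ D.image π} #{a : π a = z} · Φ z`. [folklore] -/
theorem sum_eq_sum_image_card {α β : Type*} [DecidableEq β] (D : Finset α) (π : α → β) (Φ : β → ℝ) :
    ∑ a ∈ D, Φ (π a) = ∑ z ∈ D.image π, ((D.filter fun a => π a = z).card : ℝ) * Φ z := by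
  classical
  rw [← Finset.sum_fiberwise_of_maps_to (s := D) (t := D.image π) (g := π) fun a ha => Finset.mem_image_of_mem π ha]
  refine Finset.sum_congr rfl fun z _ => ?_
  rw [Finset.sum_congr rfl fun a (ha : a ∈ D.filter fun a => π a = z) => by rw [(Finset.mem_filter.1 ha).2]]
  rw [Finset.sum_const, nsmul_eq_mul]

/-- `Σ_{z ∈ S} [z = c] · w · Φ z = w · Φ c` when `c ∈ S`. [folklore] -/
theorem sum_ite_point {β : Type*} [DecidableEq β] (S : Finset β) (c : β) (hc : c ∈ S) (w : ℝ) (Φ : β → ℝ) :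
    ∑ z ∈ S, (if c = z then w else 0) * Φ z = w * Φ c := by
  rw [Finset.sum_congr rfl fun z _ => show (if c = z then w else 0) * Φ z = if c = z then w * Φ z else 0 by
    split_ifs <;> simp]
  rw [Finset.sum_ite_eq]
  simp [hc]

end Abstract

/-! ### The data: the cherry fan in `Fin 8` and its certificate -/

section Data


/-- The certificate's cover equation (in ℕ): for every pair value `z` of the event, the number of sub-colourings with clusters `z`
equals the weighted number of cube endpoints at `z` (stated as 'no exception', decided by computation). [this work, by computation] -/
theorem cover_eq : (((((Finset.powerset (({s(0, 1), s(1, 2), s(1, 3), s(0, 2), s(0, 3)} : Finset (Sym2 (Fin 8))))).filter fun (θ : Finset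
    (Sym2 (Fin 8))) =>
  (SimpleGraph.fromEdgeSet (↑θ : Set (Sym2 (Fin 8)))).Reachable 0 1))).image (fun θ => (((fun (θ : Finset (Sym2 (Fin 8))) =>
      (Finset.univ.filter fun v : Fin 8 =>
  (SimpleGraph.fromEdgeSet (↑θ : Set (Sym2 (Fin 8)))).Reachable 0 v))) θ, ((fun (θ : Finset (Sym2 (Fin 8))) =>
      (Finset.univ.filter fun v : Fin 8 =>
  (SimpleGraph.fromEdgeSet (↑((({s(0, 1), s(1, 2), s(1, 3), s(0, 2), s(0, 3)} : Finset (Sym2 (Fin 8)))) \ θ) : Set (Sym2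
      (Fin 8)))).Reachable 0 v))) θ))).filter (fun z =>
    (((((Finset.powerset (({s(0, 1), s(1, 2), s(1, 3), s(0, 2), s(0, 3)} : Finset (Sym2 (Fin 8))))).filter fun (θ : Finset (Sym2
        (Fin 8))) =>
  (SimpleGraph.fromEdgeSet (↑θ : Set (Sym2 (Fin 8)))).Reachable 0 1))).filter fun θ => (((fun (θ : Finset (Sym2 (Fin 8))) =>
      (Finset.univ.filter fun v : Fin 8 =>
  (SimpleGraph.fromEdgeSet (↑θ : Set (Sym2 (Fin 8)))).Reachable 0 v))) θ, ((fun (θ : Finset (Sym2 (Fin 8))) =>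
      (Finset.univ.filter fun v : Fin 8 =>
  (SimpleGraph.fromEdgeSet (↑((({s(0, 1), s(1, 2), s(1, 3), s(0, 2), s(0, 3)} : Finset (Sym2 (Fin 8)))) \ θ) : Set (Sym2
      (Fin 8)))).Reachable 0 v))) θ) = z).card ≠
      (∑ i : Fin 6, ((![1, 2, 2, 2, 1, 1] : Fin 6 → ℕ)) i * ((if (((![(({0, 1} : Finset (Fin 8)), ({0, 1, 2, 3} : Finset (Fin 8))), ({0, 1,
          2}, {0, 1, 2, 3}),
  ({0, 1, 3}, {0, 1, 2, 3}), ({0, 1, 2}, {0, 1, 3}), ({0, 1, 3}, {0, 1, 2}), ({0, 1, 3}, {0, 1, 2})] :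
  Fin 6 → Finset (Fin 8) × Finset (Fin 8)))) i = z then 1 else 0) + (if (((![(({0, 1, 2, 3} : Finset (Fin 8)), ({0} : Finset (Fin 8))),
      ({0, 1, 2, 3}, {0, 2}),
  ({0, 1, 2, 3}, {0, 3}), ({0, 1, 2, 3}, {0}), ({0, 1, 2, 3}, {0}), ({0, 1, 2, 3}, {0, 1})] :
  Fin 6 → Finset (Fin 8) × Finset (Fin 8)))) i = z then 1 else 0))) +
        ∑ j : Fin 3, ((![1, 2, 2] : Fin 3 → ℕ)) j * (if (((![(({0, 1, 2, 3} : Finset (Fin 8)), ({0, 2, 3} : Finset (Fin 8))), ({0, 1, 2,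
            3}, {0, 1, 2}),
  ({0, 1, 2, 3}, {0, 1, 3})] : Fin 3 → Finset (Fin 8) × Finset (Fin 8)))) j = z then 1 else 0)) = ∅ := by
  native_decide

/-- Every cube endpoint is a pair value of the event. [this work, by computation] -/
theorem endpoints_mem : (∀ i : Fin 6, (((![(({0, 1} : Finset (Fin 8)), ({0, 1, 2, 3} : Finset (Fin 8))), ({0, 1, 2}, {0, 1, 2, 3}),
  ({0, 1, 3}, {0, 1, 2, 3}), ({0, 1, 2}, {0, 1, 3}), ({0, 1, 3}, {0, 1, 2}), ({0, 1, 3}, {0, 1, 2})] :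
  Fin 6 → Finset (Fin 8) × Finset (Fin 8)))) i ∈ ((((Finset.powerset (({s(0, 1), s(1, 2), s(1, 3), s(0, 2), s(0, 3)} : Finset (Sym2
      (Fin 8))))).filter fun (θ : Finset (Sym2 (Fin 8))) =>
  (SimpleGraph.fromEdgeSet (↑θ : Set (Sym2 (Fin 8)))).Reachable 0 1))).image (fun θ => (((fun (θ : Finset (Sym2 (Fin 8))) =>
      (Finset.univ.filter fun v : Fin 8 =>
  (SimpleGraph.fromEdgeSet (↑θ : Set (Sym2 (Fin 8)))).Reachable 0 v))) θ, ((fun (θ : Finset (Sym2 (Fin 8))) =>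
      (Finset.univ.filter fun v : Fin 8 =>
  (SimpleGraph.fromEdgeSet (↑((({s(0, 1), s(1, 2), s(1, 3), s(0, 2), s(0, 3)} : Finset (Sym2 (Fin 8)))) \ θ) : Set (Sym2
      (Fin 8)))).Reachable 0 v))) θ)) ∧ (((![(({0, 1, 2, 3} : Finset (Fin 8)), ({0} : Finset (Fin 8))), ({0, 1, 2, 3}, {0, 2}),
  ({0, 1, 2, 3}, {0, 3}), ({0, 1, 2, 3}, {0}), ({0, 1, 2, 3}, {0}), ({0, 1, 2, 3}, {0, 1})] :
  Fin 6 → Finset (Fin 8) × Finset (Fin 8)))) i ∈ ((((Finset.powerset (({s(0, 1), s(1, 2), s(1, 3), s(0, 2), s(0, 3)} : Finset (Sym2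
      (Fin 8))))).filter fun (θ : Finset (Sym2 (Fin 8))) =>
  (SimpleGraph.fromEdgeSet (↑θ : Set (Sym2 (Fin 8)))).Reachable 0 1))).image (fun θ => (((fun (θ : Finset (Sym2 (Fin 8))) =>
      (Finset.univ.filter fun v : Fin 8 =>
  (SimpleGraph.fromEdgeSet (↑θ : Set (Sym2 (Fin 8)))).Reachable 0 v))) θ, ((fun (θ : Finset (Sym2 (Fin 8))) =>
      (Finset.univ.filter fun v : Fin 8 =>
  (SimpleGraph.fromEdgeSet (↑((({s(0, 1), s(1, 2), s(1, 3), s(0, 2), s(0, 3)} : Finset (Sym2 (Fin 8)))) \ θ) : Set (Sym2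
      (Fin 8)))).Reachable 0 v))) θ)))
    ∧ ∀ j : Fin 3, (((![(({0, 1, 2, 3} : Finset (Fin 8)), ({0, 2, 3} : Finset (Fin 8))), ({0, 1, 2, 3}, {0, 1, 2}),
  ({0, 1, 2, 3}, {0, 1, 3})] : Fin 3 → Finset (Fin 8) × Finset (Fin 8)))) j ∈ ((((Finset.powerset (({s(0, 1), s(1, 2), s(1, 3), s(0, 2),
      s(0, 3)} : Finset (Sym2 (Fin 8))))).filter fun (θ : Finset (Sym2 (Fin 8))) =>
  (SimpleGraph.fromEdgeSet (↑θ : Set (Sym2 (Fin 8)))).Reachable 0 1))).image (fun θ => (((fun (θ : Finset (Sym2 (Fin 8))) =>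
      (Finset.univ.filter fun v : Fin 8 =>
  (SimpleGraph.fromEdgeSet (↑θ : Set (Sym2 (Fin 8)))).Reachable 0 v))) θ, ((fun (θ : Finset (Sym2 (Fin 8))) =>
      (Finset.univ.filter fun v : Fin 8 =>
  (SimpleGraph.fromEdgeSet (↑((({s(0, 1), s(1, 2), s(1, 3), s(0, 2), s(0, 3)} : Finset (Sym2 (Fin 8)))) \ θ) : Set (Sym2
      (Fin 8)))).Reachable 0 v))) θ)) := by
  native_decide

/-- The 1-cubes are monotone and red-dominated, the 0-cubes nested (Finset inclusions). [this work, by computation] -/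
theorem cubes_ok : (∀ i : Fin 6, ((((![(({0, 1} : Finset (Fin 8)), ({0, 1, 2, 3} : Finset (Fin 8))), ({0, 1, 2}, {0, 1, 2, 3}),
  ({0, 1, 3}, {0, 1, 2, 3}), ({0, 1, 2}, {0, 1, 3}), ({0, 1, 3}, {0, 1, 2}), ({0, 1, 3}, {0, 1, 2})] :
  Fin 6 → Finset (Fin 8) × Finset (Fin 8)))) i).1 ⊆ ((((![(({0, 1, 2, 3} : Finset (Fin 8)), ({0} : Finset (Fin 8))), ({0, 1, 2, 3}, {0, 2}),
  ({0, 1, 2, 3}, {0, 3}), ({0, 1, 2, 3}, {0}), ({0, 1, 2, 3}, {0}), ({0, 1, 2, 3}, {0, 1})] :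
  Fin 6 → Finset (Fin 8) × Finset (Fin 8)))) i).1 ∧ ((((![(({0, 1, 2, 3} : Finset (Fin 8)), ({0} : Finset (Fin 8))), ({0, 1, 2, 3}, {0, 2}),
  ({0, 1, 2, 3}, {0, 3}), ({0, 1, 2, 3}, {0}), ({0, 1, 2, 3}, {0}), ({0, 1, 2, 3}, {0, 1})] :
  Fin 6 → Finset (Fin 8) × Finset (Fin 8)))) i).2 ⊆ ((((![(({0, 1} : Finset (Fin 8)), ({0, 1, 2, 3} : Finset (Fin 8))), ({0, 1, 2}, {0, 1,
      2, 3}),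
  ({0, 1, 3}, {0, 1, 2, 3}), ({0, 1, 2}, {0, 1, 3}), ({0, 1, 3}, {0, 1, 2}), ({0, 1, 3}, {0, 1, 2})] :
  Fin 6 → Finset (Fin 8) × Finset (Fin 8)))) i).2 ∧ ((((![(({0, 1, 2, 3} : Finset (Fin 8)), ({0} : Finset (Fin 8))), ({0, 1, 2, 3}, {0, 2}),
  ({0, 1, 2, 3}, {0, 3}), ({0, 1, 2, 3}, {0}), ({0, 1, 2, 3}, {0}), ({0, 1, 2, 3}, {0, 1})] :
  Fin 6 → Finset (Fin 8) × Finset (Fin 8)))) i).2 ⊆ ((((![(({0, 1} : Finset (Fin 8)), ({0, 1, 2, 3} : Finset (Fin 8))), ({0, 1, 2}, {0, 1,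
      2, 3}),
  ({0, 1, 3}, {0, 1, 2, 3}), ({0, 1, 2}, {0, 1, 3}), ({0, 1, 3}, {0, 1, 2}), ({0, 1, 3}, {0, 1, 2})] :
  Fin 6 → Finset (Fin 8) × Finset (Fin 8)))) i).1 ∧
    ((((![(({0, 1} : Finset (Fin 8)), ({0, 1, 2, 3} : Finset (Fin 8))), ({0, 1, 2}, {0, 1, 2, 3}),
  ({0, 1, 3}, {0, 1, 2, 3}), ({0, 1, 2}, {0, 1, 3}), ({0, 1, 3}, {0, 1, 2}), ({0, 1, 3}, {0, 1, 2})] :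
  Fin 6 → Finset (Fin 8) × Finset (Fin 8)))) i).2 ⊆ ((((![(({0, 1, 2, 3} : Finset (Fin 8)), ({0} : Finset (Fin 8))), ({0, 1, 2, 3}, {0, 2}),
  ({0, 1, 2, 3}, {0, 3}), ({0, 1, 2, 3}, {0}), ({0, 1, 2, 3}, {0}), ({0, 1, 2, 3}, {0, 1})] :
  Fin 6 → Finset (Fin 8) × Finset (Fin 8)))) i).1) ∧ ∀ j : Fin 3, ((((![(({0, 1, 2, 3} : Finset (Fin 8)), ({0, 2, 3} : Finset (Fin 8))),
      ({0, 1, 2, 3}, {0, 1, 2}),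
  ({0, 1, 2, 3}, {0, 1, 3})] : Fin 3 → Finset (Fin 8) × Finset (Fin 8)))) j).2 ⊆ ((((![(({0, 1, 2, 3} : Finset (Fin 8)), ({0, 2,
      3} : Finset (Fin 8))), ({0, 1, 2, 3}, {0, 1, 2}),
  ({0, 1, 2, 3}, {0, 1, 3})] : Fin 3 → Finset (Fin 8) × Finset (Fin 8)))) j).1 := by
  decide

/-- **The cherry fan is ⊕-positive** (Finset form): `0 ≤ Σ_{θ ⊆ E₁, y ∈ X θ} K₁ (X θ) (Y θ) * K₂ (X θ) (Y θ)` for twisted-monotone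
super-odd `K₁, K₂`, clusters written as `openCluster`. [this work] -/
theorem cherry_oplus_powerset (K₁ K₂ : Set (Fin 8) → Set (Fin 8) → ℝ)
    (hK₁ : ∀ ⦃A A' B B' : Set (Fin 8)⦄, A ⊆ A' → B' ⊆ B → K₁ A B ≤ K₁ A' B') (hso₁ : ∀ A B, 0 ≤ K₁ A B + K₁ B A)
    (hK₂ : ∀ ⦃A A' B B' : Set (Fin 8)⦄, A ⊆ A' → B' ⊆ B → K₂ A B ≤ K₂ A' B') (hso₂ : ∀ A B, 0 ≤ K₂ A B + K₂ B A) :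
    0 ≤ ∑ θ ∈ (((Finset.powerset (({s(0, 1), s(1, 2), s(1, 3), s(0, 2), s(0, 3)} : Finset (Sym2 (Fin 8))))).filter fun (θ : Finset (Sym2
        (Fin 8))) =>
  (SimpleGraph.fromEdgeSet (↑θ : Set (Sym2 (Fin 8)))).Reachable 0 1)), K₁ (openCluster (↑θ : Set (Sym2 (Fin 8))) 0) (openCluster (↑((({s(0,
      1), s(1, 2), s(1, 3), s(0, 2), s(0, 3)} : Finset (Sym2 (Fin 8)))) \ θ) : Set (Sym2 (Fin 8))) 0) *
      K₂ (openCluster (↑θ : Set (Sym2 (Fin 8))) 0) (openCluster (↑((({s(0, 1), s(1, 2), s(1, 3), s(0, 2), s(0, 3)} : Finset (Sym2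
          (Fin 8)))) \ θ) : Set (Sym2 (Fin 8))) 0) := by
  -- clusters as coerced Finsets
  have hX : ∀ θ : Finset (Sym2 (Fin 8)), openCluster (↑θ : Set (Sym2 (Fin 8))) 0 = ↑(((fun (θ : Finset (Sym2 (Fin 8))) =>
      (Finset.univ.filter fun v : Fin 8 =>
  (SimpleGraph.fromEdgeSet (↑θ : Set (Sym2 (Fin 8)))).Reachable 0 v))) θ) := by
    intro θ; ext v
    simp only [Finset.coe_filter, Finset.mem_univ, true_and, Set.mem_setOf_eq]
    rfl
  let π : Finset (Sym2 (Fin 8)) → Finset (Fin 8) × Finset (Fin 8) := fun θ => (((fun (θ : Finset (Sym2 (Fin 8))) =>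
      (Finset.univ.filter fun v : Fin 8 =>
  (SimpleGraph.fromEdgeSet (↑θ : Set (Sym2 (Fin 8)))).Reachable 0 v))) θ, ((fun (θ : Finset (Sym2 (Fin 8))) =>
      (Finset.univ.filter fun v : Fin 8 =>
  (SimpleGraph.fromEdgeSet (↑((({s(0, 1), s(1, 2), s(1, 3), s(0, 2), s(0, 3)} : Finset (Sym2 (Fin 8)))) \ θ) : Set (Sym2
      (Fin 8)))).Reachable 0 v))) θ)
  let Φ : Finset (Fin 8) × Finset (Fin 8) → ℝ := fun z => K₁ (↑z.1) (↑z.2) * K₂ (↑z.1) (↑z.2)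
  have hsummand : ∀ θ ∈ (((Finset.powerset (({s(0, 1), s(1, 2), s(1, 3), s(0, 2), s(0, 3)} : Finset (Sym2 (Fin 8))))).filter fun
      (θ : Finset (Sym2 (Fin 8))) =>
  (SimpleGraph.fromEdgeSet (↑θ : Set (Sym2 (Fin 8)))).Reachable 0 1)), K₁ (openCluster (↑θ : Set (Sym2 (Fin 8))) 0) (openCluster (↑((({s(0,
      1), s(1, 2), s(1, 3), s(0, 2), s(0, 3)} : Finset (Sym2 (Fin 8)))) \ θ) : Set (Sym2 (Fin 8))) 0) *
      K₂ (openCluster (↑θ : Set (Sym2 (Fin 8))) 0) (openCluster (↑((({s(0, 1), s(1, 2), s(1, 3), s(0, 2), s(0, 3)} : Finset (Sym2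
          (Fin 8)))) \ θ) : Set (Sym2 (Fin 8))) 0) = Φ (π θ) := by
    intro θ _
    simp only [Φ, π, hX]
  rw [Finset.sum_congr rfl hsummand, sum_eq_sum_image_card ((((Finset.powerset (({s(0, 1), s(1, 2), s(1, 3), s(0, 2), s(0, 3)} : Finset
      (Sym2 (Fin 8))))).filter fun (θ : Finset (Sym2 (Fin 8))) =>
  (SimpleGraph.fromEdgeSet (↑θ : Set (Sym2 (Fin 8)))).Reachable 0 1))) π Φ]
  -- replace the fibre counts by the certificate
  have hcov : ∀ z ∈ ((((Finset.powerset (({s(0, 1), s(1, 2), s(1, 3), s(0, 2), s(0, 3)} : Finset (Sym2 (Fin 8))))).filter fun (θ : Finset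
      (Sym2 (Fin 8))) =>
  (SimpleGraph.fromEdgeSet (↑θ : Set (Sym2 (Fin 8)))).Reachable 0 1))).image π, ((((((Finset.powerset (({s(0, 1), s(1, 2), s(1, 3), s(0,
      2), s(0, 3)} : Finset (Sym2 (Fin 8))))).filter fun (θ : Finset (Sym2 (Fin 8))) =>
  (SimpleGraph.fromEdgeSet (↑θ : Set (Sym2 (Fin 8)))).Reachable 0 1))).filter fun θ => π θ = z).card : ℝ) =
      ((∑ i : Fin 6, ((![1, 2, 2, 2, 1, 1] : Fin 6 → ℕ)) i * ((if (((![(({0, 1} : Finset (Fin 8)), ({0, 1, 2, 3} : Finset (Fin 8))), ({0,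
          1, 2}, {0, 1, 2, 3}),
  ({0, 1, 3}, {0, 1, 2, 3}), ({0, 1, 2}, {0, 1, 3}), ({0, 1, 3}, {0, 1, 2}), ({0, 1, 3}, {0, 1, 2})] :
  Fin 6 → Finset (Fin 8) × Finset (Fin 8)))) i = z then 1 else 0) + (if (((![(({0, 1, 2, 3} : Finset (Fin 8)), ({0} : Finset (Fin 8))),
      ({0, 1, 2, 3}, {0, 2}),
  ({0, 1, 2, 3}, {0, 3}), ({0, 1, 2, 3}, {0}), ({0, 1, 2, 3}, {0}), ({0, 1, 2, 3}, {0, 1})] :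
  Fin 6 → Finset (Fin 8) × Finset (Fin 8)))) i = z then 1 else 0))) +
        ∑ j : Fin 3, ((![1, 2, 2] : Fin 3 → ℕ)) j * (if (((![(({0, 1, 2, 3} : Finset (Fin 8)), ({0, 2, 3} : Finset (Fin 8))), ({0, 1, 2,
            3}, {0, 1, 2}),
  ({0, 1, 2, 3}, {0, 1, 3})] : Fin 3 → Finset (Fin 8) × Finset (Fin 8)))) j = z then 1 else 0) : ℕ) := by
    intro z hz
    have h := Finset.filter_eq_empty_iff.1 cover_eq hz
    push Not at h
    exact_mod_cast h
  rw [Finset.sum_congr rfl fun z hz => by rw [hcov z hz]]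
  -- expand and regroup by cubes
  have hmem := endpoints_mem
  have hok := cubes_ok
  simp only [Nat.cast_add, Nat.cast_sum, Nat.cast_mul, Nat.cast_ite, Nat.cast_one, Nat.cast_zero, add_mul, Finset.sum_add_distrib,
    Finset.sum_mul]
  rw [Finset.sum_comm, Finset.sum_comm (s := ((((Finset.powerset (({s(0, 1), s(1, 2), s(1, 3), s(0, 2), s(0, 3)} : Finset (Sym2
      (Fin 8))))).filter fun (θ : Finset (Sym2 (Fin 8))) =>
  (SimpleGraph.fromEdgeSet (↑θ : Set (Sym2 (Fin 8)))).Reachable 0 1))).image π)]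
  refine add_nonneg (Finset.sum_nonneg fun i _ => ?_) (Finset.sum_nonneg fun j _ => ?_)
  · -- 1-cube `i`
    have e1 : ∑ z ∈ ((((Finset.powerset (({s(0, 1), s(1, 2), s(1, 3), s(0, 2), s(0, 3)} : Finset (Sym2 (Fin 8))))).filter fun (θ : Finset
        (Sym2 (Fin 8))) =>
  (SimpleGraph.fromEdgeSet (↑θ : Set (Sym2 (Fin 8)))).Reachable 0 1))).image π, (((![1, 2, 2, 2, 1, 1] : Fin 6 → ℕ)) i : ℝ) * ((if
      (((![(({0, 1} : Finset (Fin 8)), ({0, 1, 2, 3} : Finset (Fin 8))), ({0, 1, 2}, {0, 1, 2, 3}),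
  ({0, 1, 3}, {0, 1, 2, 3}), ({0, 1, 2}, {0, 1, 3}), ({0, 1, 3}, {0, 1, 2}), ({0, 1, 3}, {0, 1, 2})] :
  Fin 6 → Finset (Fin 8) × Finset (Fin 8)))) i = z then (1 : ℝ) else 0) + (if (((![(({0, 1, 2, 3} : Finset (Fin 8)), ({0} : Finset
      (Fin 8))), ({0, 1, 2, 3}, {0, 2}),
  ({0, 1, 2, 3}, {0, 3}), ({0, 1, 2, 3}, {0}), ({0, 1, 2, 3}, {0}), ({0, 1, 2, 3}, {0, 1})] :
  Fin 6 → Finset (Fin 8) × Finset (Fin 8)))) i = z then (1 : ℝ) else 0)) * Φ z =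
        (((![1, 2, 2, 2, 1, 1] : Fin 6 → ℕ)) i : ℝ) * (Φ ((((![(({0, 1} : Finset (Fin 8)), ({0, 1, 2, 3} : Finset (Fin 8))), ({0, 1, 2},
            {0, 1, 2, 3}),
  ({0, 1, 3}, {0, 1, 2, 3}), ({0, 1, 2}, {0, 1, 3}), ({0, 1, 3}, {0, 1, 2}), ({0, 1, 3}, {0, 1, 2})] :
  Fin 6 → Finset (Fin 8) × Finset (Fin 8)))) i) + Φ ((((![(({0, 1, 2, 3} : Finset (Fin 8)), ({0} : Finset (Fin 8))), ({0, 1, 2, 3}, {0, 2}),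
  ({0, 1, 2, 3}, {0, 3}), ({0, 1, 2, 3}, {0}), ({0, 1, 2, 3}, {0}), ({0, 1, 2, 3}, {0, 1})] :
  Fin 6 → Finset (Fin 8) × Finset (Fin 8)))) i)) := by
      rw [Finset.sum_congr rfl fun z _ => show (((![1, 2, 2, 2, 1, 1] : Fin 6 → ℕ)) i : ℝ) * ((if (((![(({0, 1} : Finset (Fin 8)), ({0, 1,
          2, 3} : Finset (Fin 8))), ({0, 1, 2}, {0, 1, 2, 3}),
  ({0, 1, 3}, {0, 1, 2, 3}), ({0, 1, 2}, {0, 1, 3}), ({0, 1, 3}, {0, 1, 2}), ({0, 1, 3}, {0, 1, 2})] :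
  Fin 6 → Finset (Fin 8) × Finset (Fin 8)))) i = z then (1 : ℝ) else 0) + (if (((![(({0, 1, 2, 3} : Finset (Fin 8)), ({0} : Finset
      (Fin 8))), ({0, 1, 2, 3}, {0, 2}),
  ({0, 1, 2, 3}, {0, 3}), ({0, 1, 2, 3}, {0}), ({0, 1, 2, 3}, {0}), ({0, 1, 2, 3}, {0, 1})] :
  Fin 6 → Finset (Fin 8) × Finset (Fin 8)))) i = z then (1 : ℝ) else 0)) * Φ z
          = (if (((![(({0, 1} : Finset (Fin 8)), ({0, 1, 2, 3} : Finset (Fin 8))), ({0, 1, 2}, {0, 1, 2, 3}),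
  ({0, 1, 3}, {0, 1, 2, 3}), ({0, 1, 2}, {0, 1, 3}), ({0, 1, 3}, {0, 1, 2}), ({0, 1, 3}, {0, 1, 2})] :
  Fin 6 → Finset (Fin 8) × Finset (Fin 8)))) i = z then (((![1, 2, 2, 2, 1, 1] : Fin 6 → ℕ)) i : ℝ) else 0) * Φ z + (if (((![(({0, 1, 2,
      3} : Finset (Fin 8)), ({0} : Finset (Fin 8))), ({0, 1, 2, 3}, {0, 2}),
  ({0, 1, 2, 3}, {0, 3}), ({0, 1, 2, 3}, {0}), ({0, 1, 2, 3}, {0}), ({0, 1, 2, 3}, {0, 1})] :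
  Fin 6 → Finset (Fin 8) × Finset (Fin 8)))) i = z then (((![1, 2, 2, 2, 1, 1] : Fin 6 → ℕ)) i : ℝ) else 0) * Φ z by
          split_ifs <;> ring]
      rw [Finset.sum_add_distrib, sum_ite_point _ _ (hmem.1 i).1, sum_ite_point _ _ (hmem.1 i).2]; ring
    rw [e1]
    refine mul_nonneg (Nat.cast_nonneg _) ?_
    obtain ⟨h1, h2, h3, h4⟩ := hok.1 i
    exact one_cube_nonneg _ _ _ _ (Finset.coe_subset.2 h1) (Finset.coe_subset.2 h2) (Finset.coe_subset.2 h3)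
      (Finset.coe_subset.2 h4) hK₁ hso₁ hK₂ hso₂
  · -- 0-cube `j`
    have e0 : ∑ z ∈ ((((Finset.powerset (({s(0, 1), s(1, 2), s(1, 3), s(0, 2), s(0, 3)} : Finset (Sym2 (Fin 8))))).filter fun (θ : Finset
        (Sym2 (Fin 8))) =>
  (SimpleGraph.fromEdgeSet (↑θ : Set (Sym2 (Fin 8)))).Reachable 0 1))).image π, (((![1, 2, 2] : Fin 3 → ℕ)) j : ℝ) * (if (((![(({0, 1, 2,
      3} : Finset (Fin 8)), ({0, 2, 3} : Finset (Fin 8))), ({0, 1, 2, 3}, {0, 1, 2}),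
  ({0, 1, 2, 3}, {0, 1, 3})] : Fin 3 → Finset (Fin 8) × Finset (Fin 8)))) j = z then (1 : ℝ) else 0) * Φ z = (((![1, 2,
      2] : Fin 3 → ℕ)) j : ℝ) * Φ ((((![(({0, 1, 2, 3} : Finset (Fin 8)), ({0, 2, 3} : Finset (Fin 8))), ({0, 1, 2, 3}, {0, 1, 2}),
  ({0, 1, 2, 3}, {0, 1, 3})] : Fin 3 → Finset (Fin 8) × Finset (Fin 8)))) j) := by
      rw [Finset.sum_congr rfl fun z _ => show (((![1, 2, 2] : Fin 3 → ℕ)) j : ℝ) * (if (((![(({0, 1, 2, 3} : Finset (Fin 8)), ({0, 2,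
          3} : Finset (Fin 8))), ({0, 1, 2, 3}, {0, 1, 2}),
  ({0, 1, 2, 3}, {0, 1, 3})] : Fin 3 → Finset (Fin 8) × Finset (Fin 8)))) j = z then (1 : ℝ) else 0) * Φ z
          = (if (((![(({0, 1, 2, 3} : Finset (Fin 8)), ({0, 2, 3} : Finset (Fin 8))), ({0, 1, 2, 3}, {0, 1, 2}),
  ({0, 1, 2, 3}, {0, 1, 3})] : Fin 3 → Finset (Fin 8) × Finset (Fin 8)))) j = z then (((![1, 2, 2] : Fin 3 → ℕ)) j : ℝ) else 0)
      * Φ z by split_ifs <;> ring]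
      rw [sum_ite_point _ _ (hmem.2 j)]
    rw [e0]
    exact mul_nonneg (Nat.cast_nonneg _) (zero_cube_nonneg _ _ (Finset.coe_subset.2 (hok.2 j)) hK₁ hso₁ hK₂ hso₂)

end Data

end Cherry

end Antithetic

end Summit.CriticalPhenomena.PercolationContinuityZ3.Theorems
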